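import Summits.QuantumFields.YangMills.Theorems.LuscherReductionDressedRitzLiftLeakageEuclidean
import Summits.QuantumFields.YangMills.Theorems.LuscherReductionDressedRitzPolyakovLiftSlabChannelUniversality
import HarnessLib

/-!
# Crux `DressedRitz` (stmt-QuantumFields-20205), line «polyakovlift» r5, stub S-LEAK `stub_liftLeakage` — support XVIII:
# the FINITE-SLAB form of S-LEAK: (E4) for free-boundary slab ratios `∀ M ≥ M₀` ⟹ `EuclideanLeakageAt k` ⟹ the registered text

Support module (fleet seat ym-20205-polyakovlift-s1 gen 1; `--supports stmt-QuantumFields-20205`, helper, no closure claim).  Twin, for S-LEAK, of the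
lead's `…PolyakovLiftSlabChannelUniversality.lean` (p540780: `slabCorr`, `tendsto_slabCorr`, `SlabChannelUniversalityAt → ChannelUniversalityAt`).  The
Euclidean target of S-LEAK (XII, p540608: `EuclideanLeakageAt k`, (E4) `c(2L+2)c(2L) − c(2L+1)² ≤ C(λ³/L²)c(2L)²` for the normalised connected
flowed-Polyakov autocorrelation `c = corr β φ G · i i`) is the `M → ∞` limit of the same inequality for the SLAB RATIOS
`slabCorr β φ G t i i M = ⟨(G_i − c_i)Φ_M, K_β^[t]((G_i − c_i)Φ_M)⟩ / ⟨Φ_M, K_β^[t]Φ_M⟩` (`Φ_M = K_β^M 1`; two free-boundary slab path integrals on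
`L³ × (2M + t)` with constant-subtracted insertions; `tendsto_slabCorr` = the vacuum dictionary at the raw vacuum's own package):

* `SlabLeakageAt k` — (E4) with `slabCorr … M` in place of `corr …`, asserted for all `M ≥ M₀` (same quantifier prefix as the stub; no division, so no
  positivity proviso is needed in the limit);
* ★ `euclideanLeakage_of_slab : SlabLeakageAt k → EuclideanLeakageAt k` (same `C`, `lam0`, `L0`);
* ★★ `liftLeakage_of_slab : (∀ k, SlabLeakageAt k) →` the r5 text of `Stmt.stub_liftLeakage` VERBATIM (via XII `liftLeakage_iff_euclidean`).

So S-LEAK, like S-UNIV′, reads: «a dimensionless inequality between finite-volume Euclidean path integrals on `L³ × T` with two flowed-Polyakov insertions at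
separations `2L, 2L+1, 2L+2`, uniformly in `T ≥ T₀`» — the form a Bałaban-type small-field expansion consumes.  Not proved here; no claim on the stub.

HONEST FRAMING: fixed-lattice bookkeeping on the conditional femto rung R2b1; `stub_liftLeakage` stays OPEN; nothing here bears on infinite volume, the
continuum limit or the Clay gap.
References: E. Seiler, LNP 159 (1982) §3 [cite: SeilerLNP1982, §3]; M. Lüscher, U. Wolff, NPB 339 (1990) 222 [cite: LuscherWolff1990, §2];
M. Lüscher, NPB 219 (1983) 233 [cite: Luscher1983, §3].
-/

set_option autoImplicit false

noncomputable section

open MeasureTheory Filter Topology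
open Literature.MathematicalPhysics.QuantumFieldTheory (GaugeConfig Site gaugeTransform)
open scoped BigOperators

namespace Summit.QuantumFields.YangMills.Theorems.FemtoTransferGap.LiftLeak

open Summit.QuantumFields.YangMills.Theorems.FemtoTransferGap
open Summit.QuantumFields.YangMills.Theorems.FemtoTransferGap.PolyakovLift

/-- **`SlabLeakageAt k`** — S-LEAK in finite-slab currency: deep in the femto window, for every raw vacuum `φ` and every lift basis `(ω,g)` at `B₁`, there is
`M₀` such that for all slab parameters `M ≥ M₀`, with `s(t) = slabCorr β φ (flowLiftAt 0 (flowTime β L) ∘ g) t i i M` and `m = dressSteps L`: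
(E4-slab) `s(2m+2)·s(2m) − s(2m+1)² ≤ C(λ³/L²)·s(2m)²` for every channel `i`. [cite: SeilerLNP1982, §3] [cite: LuscherWolff1990, §2] -/
def SlabLeakageAt (k : ℕ) : Prop :=
  ∃ C lam0 : ℝ, 0 ≤ C ∧ 0 < lam0 ∧ ∀ lam : ℝ, 0 < lam → lam ≤ lam0 → ∃ L0 : ℕ,
    ∀ (L : ℕ) [NeZero L], L0 ≤ L → ∀ β : ℝ, InFemtoWindow lam β L →
      ∀ φ : GaugeConfig 3 L SU2 → ℝ, IsRawVacuum β φ →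
        ∀ (ω : GaugeConfig 3 1 SU2 → ℝ) (g : Fin k → (GaugeConfig 3 1 SU2 → ℝ)), LiftBasis (liftCoupling β L) k ω g →
          let s := slabCorr β φ (fun i => flowLiftAt (L := L) 0 (flowTime β L) (g i))
          let m := dressSteps L
          ∃ M0 : ℕ, ∀ M : ℕ, M0 ≤ M → ∀ i : Fin k,
            s (2 * m + 2) i i M * s (2 * m) i i M - s (2 * m + 1) i i M ^ 2 ≤ C * (luscherLambda β L ^ 3 / (L : ℝ) ^ 2) * s (2 * m) i i M ^ 2

/-- ★ **`SlabLeakageAt k → EuclideanLeakageAt k`** (same constants): pass to the limit `M → ∞` in (E4-slab) with `tendsto_slabCorr`. [cite: SeilerLNP1982, §3] -/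
theorem euclideanLeakage_of_slab {k : ℕ} (h : SlabLeakageAt k) : EuclideanLeakageAt k := by
  obtain ⟨C, lam0, hC, hlam0, hk⟩ := h
  refine ⟨C, lam0, hC, hlam0, fun lam hlam hle => ?_⟩
  obtain ⟨L0, hL⟩ := hk lam hlam hle
  refine ⟨L0, fun L _ hL0 β hW φ hφ ω g hbasis => ?_⟩
  obtain ⟨M0, hM⟩ := hL L hL0 β hW φ hφ ω g hbasis
  have hβ : 0 < β := zero_lt_one.trans_le hW.1
  set m := dressSteps L with hm
  set G : Fin k → (GaugeConfig 3 L SU2 → ℝ) := fun i => flowLiftAt (L := L) 0 (flowTime β L) (g i) with hG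
  have hGi : ∀ i, IsPhys (G i) := fun i => isPhys_flowLiftAt 0 _ (hbasis.2.2.2.2.1 i)
  have T : ∀ (t : ℕ) (i : Fin k), Tendsto (slabCorr β φ G t i i) atTop (𝓝 (corr β φ G t i i)) :=
    fun t i => tendsto_slabCorr hβ.le hφ hGi t i i
  have hev : ∀ᶠ M in atTop, M0 ≤ M := eventually_ge_atTop M0
  intro c m' i
  show c (2 * m' + 2) i i * c (2 * m') i i - c (2 * m' + 1) i i ^ 2 ≤ C * (luscherLambda β L ^ 3 / (L : ℝ) ^ 2) * c (2 * m') i i ^ 2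
  refine le_of_tendsto_of_tendsto (((T _ i).mul (T _ i)).sub ((T _ i).pow 2)) (((T _ i).pow 2).const_mul _) ?_
  exact hev.mono fun M hMM => hM M hMM i

/-- ★★ **`(∀ k, SlabLeakageAt k)` ⟹ the registered r5 text of `Stmt.stub_liftLeakage` VERBATIM** (slab ⟹ Euclidean ⟹ (o4), XII). [cite: LuscherWolff1990, §2] [cite: Luscher1983, §3] -/
theorem liftLeakage_of_slab (h : ∀ k : ℕ, SlabLeakageAt k) :
    ∀ k : ℕ, ∃ C lam0 : ℝ, 0 ≤ C ∧ 0 < lam0 ∧ ∀ lam : ℝ, 0 < lam → lam ≤ lam0 → ∃ L0 : ℕ,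
      ∀ (L : ℕ) [NeZero L], L0 ≤ L → ∀ β : ℝ, InFemtoWindow lam β L →
        ∀ φ : GaugeConfig 3 L SU2 → ℝ, IsRawVacuum β φ →
          ∀ (ω : GaugeConfig 3 1 SU2 → ℝ) (g : Fin k → (GaugeConfig 3 1 SU2 → ℝ)), LiftBasis (liftCoupling β L) k ω g →
            LeakageClause k C β (dressedLiftFamily β φ g) :=
  liftLeakage_iff_euclidean.1 fun k => euclideanLeakage_of_slab (h k)

end Summit.QuantumFields.YangMills.Theorems.FemtoTransferGap.LiftLeak

end
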